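import Literature.AlgebraicGeometry.Motives.UniversalHypersurfaceRegularLocusChartEquation
import Literature.AlgebraicGeometry.Motives.UniversalHypersurfaceRegularLocusSubmersion
import HarnessLib

/-!
# Chart coordinates over nonsingular forms are attained: `(b', y) ∈ Φᵢ(𝒴°(ℂ)ᵢ)`

Family `hodge`, layer `Literature/AlgebraicGeometry/Motives`. If the form with coefficient vector `regChartCoeffVec n d i (b', y)` (the solved
coefficients) is nonsingular, then `(b', y)` is the chart coordinate vector of a point of `𝒴°(ℂ)ᵢ`
(`UniversalHypersurfaceRegularLocusSubmersion.exists_regChartFun_eq` with the equation `UniversalHypersurfaceRegularLocusChartEquation`). This is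
how the model isotopy of the degeneration programme (`HodgeTheory/CyclicCoverNodalMeridianLocalMonodromyBound`), which moves the affine coordinates
`y` of a point of a smooth fibre and keeps `b'`, is realised by points of `𝒴°(ℂ)`.

* `exists_regChartFun_eq_of_nonsingular` — `∃ Q ∈ 𝒴°(ℂ)ᵢ, regChartFun Q = (b', y)` (and `b(Q) = regChartCoeffVec (b', y)`);
* `mem_image_regChartFun_of_nonsingular` — `(b', y) ∈ regChartFun '' regChartDom`.

Everything is proved; no definitions, no named facts.

## References

* [VoisinHodgeII2003] C. Voisin, Hodge Theory and Complex Algebraic Geometry II (2003), §6.2.1.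
* [BrockerJanichIDT1982] T. Bröcker, K. Jänich, Introduction to Differential Topology (1982), §5.
-/

noncomputable section

open MvPolynomial Set Function
open Literature.AlgebraicGeometry.HodgeTheory

namespace Literature.AlgebraicGeometry.Motives.UniversalHypersurface

variable (n d : ℕ) (i : Fin (n + 2))

/-- **Chart coordinates over nonsingular forms are attained.** [cite: VoisinHodgeII2003, §6.2.1] [cite: BrockerJanichIDT1982, §5] -/
theorem exists_regChartFun_eq_of_nonsingular (hd : 0 < d)
    (v : ({m : DegIndex n d // m ≠ regPowIndex n d i} ⊕ Fin (n + 1)) → ℂ)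
    (hv : SmoothHypersurface.IsNonsingularForm ℂ (formOfCoeffs (regChartCoeffVec n d i v))) :
    ∃ Q ∈ regChartDom n d i, regCoeff ℂ n d Q = regChartCoeffVec n d i v ∧ regChartFun n d i Q = v := by
  obtain ⟨Q, hQ, hQb, hQv⟩ := exists_regChartFun_eq n d i hd hv (w := fun j => v (Sum.inr j))
    (eval_formOfCoeffs_regChartCoeffVec n d i v)
  refine ⟨Q, hQ, hQb, ?_⟩
  rw [hQv]
  funext s
  rcases s with m | j
  · exact regChartCoeffVec_of_ne n d i v m.2
  · rfl

/-- **`(b', y) ∈ regChartFun '' regChartDom`** when the solved form is nonsingular. [cite: VoisinHodgeII2003, §6.2.1] -/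
theorem mem_image_regChartFun_of_nonsingular (hd : 0 < d)
    (v : ({m : DegIndex n d // m ≠ regPowIndex n d i} ⊕ Fin (n + 1)) → ℂ)
    (hv : SmoothHypersurface.IsNonsingularForm ℂ (formOfCoeffs (regChartCoeffVec n d i v))) :
    v ∈ regChartFun n d i '' regChartDom n d i := by
  obtain ⟨Q, hQ, -, hQv⟩ := exists_regChartFun_eq_of_nonsingular n d i hd v hv
  exact ⟨Q, hQ, hQv⟩

end Literature.AlgebraicGeometry.Motives.UniversalHypersurface

end
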